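import Summits.BirchSwinnertonDyer.BirchSwinnertonDyer.Theorems.SignedSupersingularInputs
import HarnessLib

set_option linter.dupNamespace false
set_option autoImplicit false

/-!
# Rung K3 (ladder BSD) — the Theorems-side BRIDGE of route `SignedLowerHalves` with its three
# all-ranks cruxes CUT to the analytic ranks the leaf uses (pre-requisite A of K3 turnkey #4,
# pen bsd-ssimc-plan g34, `bsd-ssimc-plan/K3-route/rankcut-crux5-g34/README.md`; seat bsd-line-slh-p2 gen 7)

ROUTE-INDEPENDENT (imports only the bridge `Theorems/SignedSupersingularInputs.lean`, p405667, no `Theses`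
file), so that a future deciding theorem of the route can be a one-line application of it. Pure
re-threading of `SignedSupersingular.signedSupersingular_of_lowerHalves`: the rung-K3 leaf
`Summit.BirchSwinnertonDyer.Rank1Residual.Supersingular.SignedSupersingular` binds `W.analyticRank ≤ 1`
(and keys its X6 clause to `W.analyticRank = 0`) BEFORE the cruxes are applied, so

* `signedSupersingular_of_lowerHalves_rankLeOne` — the bridge VERBATIM except that hypothesis `hB3` (crux 5
  `SprungLowerHalfAtThree`, X8) is WEAKENED to its restriction to `W.analyticRank ≤ 1` (the text of
  `rankcut-crux5-g34/signature.txt` = item-to-be `SprungLowerHalfAtThreeRankLeOne`) and applied as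
  `hB3 W p hX hr` — exactly the shape the turnkey's `glue.lean` expects (`closes := … hB1 hB2 hB2' hB3 hR8 hPub`);
* `signedSupersingular_of_lowerHalves_allCuts` — the same with ALL THREE all-ranks cruxes weakened: `hB1`
  (crux 2 `KobayashiLowerHalfSemistable`, X6) to `W.analyticRank = 0`, `hB2` (crux 3
  `KobayashiLowerHalfLargeImage`, X7 large image) to `W.analyticRank ≤ 1`, `hB3` as above; `hB2'`, `hR8`,
  `hPub` verbatim. The route-named forms of the X6 / X7 cuts are `SemistableRankCut` (p623557) and
  `LargeImageRankCut` (p617986); this file is their route-independent common source for a `closes` edit.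

HONEST FRAMING: every open input stays an explicit hypothesis; nothing is asserted about any curve; the leaf
and all six route items stay OPEN; BSD is not proved by any of this.
[cite: Kobayashi2003, Thm. 1.2, Thm. 4.1 and Conjecture (p. 2)] [cite: Miller2011LMS, Def. 1.1]
-/

noncomputable section

namespace Summit.BirchSwinnertonDyer.BirchSwinnertonDyer.Theorems.SignedSupersingular

open Literature

/-- **Rung K3, assembled with ALL THREE all-ranks cruxes cut to the leaf's ranks**: crux 2 (X6) restricted to
`W.analyticRank = 0`, crux 3 (X7, large image) and crux 5 (X8) restricted to `W.analyticRank ≤ 1`; the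
small-image equality (crux 4), the X8 residual and the published bundle verbatim. Proof = the bridge
`signedSupersingular_of_lowerHalves` re-run, feeding the leaf's own `hr : W.analyticRank ≤ 1` / `h0 :
W.analyticRank = 0` to the three cruxes. Every hypothesis explicit; closes nothing.
[cite: Kobayashi2003, Thm. 1.2, Thm. 4.1 and Conjecture (p. 2)] [cite: Miller2011LMS, Def. 1.1] -/
theorem signedSupersingular_of_lowerHalves_allCuts
    (hB1 : ∀ (W : WeierstrassCurve ℚ) [W.IsElliptic] [W.IsGloballyMinimal] (p : ℕ) [Fact p.Prime], p ≠ 2 → Literature.NumberTheory.EllipticCurves.Rank1Residual.ClassX6 W p → W.analyticRank = 0 → ∃ ε : ℤˣ, Summit.BirchSwinnertonDyer.Rank1Residual.Supersingular.KobayashiLowerDivisibility W p ε)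
    (hB2 : ∀ (W : WeierstrassCurve ℚ) [W.IsElliptic] [W.IsGloballyMinimal] (p : ℕ) [Fact p.Prime], p ≠ 2 → Literature.NumberTheory.EllipticCurves.Rank1Residual.ClassX7 W p → ¬ W.HasCM → W.frobeniusTrace p = 0 → Literature.NumberTheory.EllipticCurves.Rank1Residual.Surj W p → W.analyticRank ≤ 1 → ∃ ε : ℤˣ, Summit.BirchSwinnertonDyer.Rank1Residual.Supersingular.KobayashiLowerDivisibility W p ε)
    (hB2' : ∀ (W : WeierstrassCurve ℚ) [W.IsElliptic] [W.IsGloballyMinimal] (p : ℕ) [Fact p.Prime], p ≠ 2 → Literature.NumberTheory.EllipticCurves.Rank1Residual.ClassX7 W p → ¬ W.HasCM → W.frobeniusTrace p = 0 → ¬ Literature.NumberTheory.EllipticCurves.Rank1Residual.Surj W p → ∃ ε : ℤˣ, Summit.BirchSwinnertonDyer.Rank1Residual.Supersingular.KobayashiMainConjecture W p ε)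
    (hB3 : ∀ (W : WeierstrassCurve ℚ) [W.IsElliptic] [W.IsGloballyMinimal] (p : ℕ) [Fact p.Prime], Literature.NumberTheory.EllipticCurves.Rank1Residual.ClassX8 W p → W.analyticRank ≤ 1 → ∃ (N : ℕ) (_ : NeZero N) (f : CuspForm (CongruenceSubgroup.Gamma0 N) 2) (ϖ : ℚ) (Lsharp Lflat : Literature.NumberTheory.EllipticCurves.IwasawaAlgebra p) (c : Literature.NumberTheory.EllipticCurves.Sprung2017.Chroma) (ξ : Literature.NumberTheory.EllipticCurves.IwasawaAlgebra p), Literature.NumberTheory.EllipticCurves.ModularForms.IsNewformOf W f ∧ (ϖ : ℝ) * W.realPeriodRat = Literature.NumberTheory.EllipticCurves.ModularForms.plusPeriod f ∧ Literature.NumberTheory.EllipticCurves.Sprung2017.IsSprungPair f p (W.frobeniusTrace p) Lsharp Lflat ∧ (⟨ξ, 0, 0⟩ : Summit.BirchSwinnertonDyer.Rank1Residual.Supersingular.SignedDatum W p).EulerCharacteristic ∧ ∃ h : Literature.NumberTheory.EllipticCurves.IwasawaAlgebra p, Literature.NumberTheory.EllipticCurves.iwasawaToPowerSeries p ξ = PowerSeries.C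 (ϖ : ℚ_[p]) * Literature.NumberTheory.EllipticCurves.iwasawaToPowerSeries p (Literature.NumberTheory.EllipticCurves.Sprung2017.chromaticL c Lsharp Lflat * h))
    (hR8 : ∀ (W : WeierstrassCurve ℚ) [W.IsElliptic] [W.IsGloballyMinimal] (p : ℕ) [Fact p.Prime], Literature.NumberTheory.EllipticCurves.Rank1Residual.ClassX8 W p → W.analyticRank ≤ 1 → ¬ (W.analyticRank = 0 ∧ Literature.NumberTheory.EllipticCurves.Rank1Residual.Surj W p) → Literature.NumberTheory.EllipticCurves.Rank1Residual.Typed.MissingPPartAt W p)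
    (hPub : Literature.NumberTheory.EllipticCurves.Wuthrich2014.sha_dvd_analyticSha ∧ Literature.NumberTheory.EllipticCurves.Kobayashi2003.thm12_signedSelmerDual_finite_torsion ∧ Literature.NumberTheory.EllipticCurves.Kobayashi2003.thm41_signedCharIdeal_divisibility ∧ Literature.NumberTheory.EllipticCurves.BDKim2013.cor315_signedCharValue_rankZero ∧ Literature.NumberTheory.EllipticCurves.BurungaleKobayashiOta2024.corA5_pPart_of_signedCharIdeal_eq ∧ Literature.NumberTheory.EllipticCurves.realPeriodRat_eq_unit_mul_plusPeriod ∧ Literature.NumberTheory.EllipticCurves.realPeriodRat_eq_unit_mul_plusPeriod_three ∧ Literature.NumberTheory.EllipticCurves.ModularForms.nonempty_modularParametrizationData ∧ WeierstrassCurve.hasEntireLFunction_rat ∧ Literature.NumberTheory.EllipticCurves.rank_eq_analyticRank_of_analyticRank_le_one) :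
    Summit.BirchSwinnertonDyer.Rank1Residual.Supersingular.SignedSupersingular := by
  intro W _ _ p _ hr hcm hp
  obtain ⟨hW, h12, h41, hKim, hA5, h5, h3, hmodP, hmod, hGZK⟩ := hPub
  haveI : Finite W.sha := (hGZK W hr).2
  have hPP := fun h ↦ Literature.NumberTheory.EllipticCurves.Rank1Residual.Typed.missingPPartAt_of_bsdp W p h
  have hLU := fun h ↦ Literature.NumberTheory.EllipticCurves.Rank1Residual.Typed.lower_and_upper_of_missingPPartAt W p h
  have toX6 : Literature.NumberTheory.EllipticCurves.Rank1Residual.Typed.MissingPPartAt W p → Literature.NumberTheory.EllipticCurves.Rank1Residual.Typed.X6.MissingInputAt W p := fun h ↦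
    ⟨fun _ _ _ ↦ (hLU h).1, fun _ ↦ h⟩
  have toX7 : Literature.NumberTheory.EllipticCurves.Rank1Residual.Typed.MissingPPartAt W p → Literature.NumberTheory.EllipticCurves.Rank1Residual.Typed.X7.MissingInputAt W p := fun h ↦
    ⟨fun _ _ _ ↦ (hLU h).1, fun _ ↦ h⟩
  have toX8 : Literature.NumberTheory.EllipticCurves.Rank1Residual.Typed.MissingPPartAt W p → Literature.NumberTheory.EllipticCurves.Rank1Residual.Typed.X8.MissingInputAt W p := fun h ↦
    ⟨fun _ _ ↦ (hLU h).1, fun _ ↦ h⟩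
  -- corner X8 (used twice: directly, and for the `a_3 = ±3` pairs of corner X7 at `p = 3`)
  have hX8 : Literature.NumberTheory.EllipticCurves.Rank1Residual.ClassX8 W p → Literature.NumberTheory.EllipticCurves.Rank1Residual.Typed.X8.MissingInputAt W p := by
    intro hX
    by_cases hc : W.analyticRank = 0 ∧ Literature.NumberTheory.EllipticCurves.Rank1Residual.Surj W p
    · obtain ⟨N, _, f, ϖ, Lsharp, Lflat, c, ξ, hf, hϖ, hSP, hK, hdiv⟩ := hB3 W p hX hr
      exact Summit.BirchSwinnertonDyer.Rank1Residual.Supersingular.X8.missingInputAt_of_chromaticLowerDivisibility_of_surj W p hGZK hmod hX hc.2 hc.1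
        hf hϖ hSP c ξ hK hdiv
    · exact toX8 (hR8 W p hX hr hc)
  refine ⟨fun hX h0 ↦ ?_, fun hX ↦ ?_, hX8⟩
  · -- corner X6
    obtain ⟨ε, hlow⟩ := hB1 W p hp hX h0
    exact toX6 (hPP (Summit.BirchSwinnertonDyer.Rank1Residual.Supersingular.X6.bsdp_of_lowerDivisibility W p hW h12 h41 hKim hA5 h5 h3 hmodP hmod hGZK
      hp hX hr ε hlow))
  · -- corner X7
    by_cases hap : W.frobeniusTrace p = 0
    · by_cases hs : Literature.NumberTheory.EllipticCurves.Rank1Residual.Surj W p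
      · obtain ⟨ε, hlow⟩ := hB2 W p hp hX hcm hap hs hr
        exact toX7 (hPP (Summit.BirchSwinnertonDyer.Rank1Residual.Supersingular.X7.bsdp_of_lowerDivisibility_of_surj W p hW h12 h41 hKim hA5 h5 h3
          hmodP hmod hGZK hp hX hap hs hr ε hlow))
      · obtain ⟨ε, hMC⟩ := hB2' W p hp hX hcm hap hs
        rcases Nat.le_one_iff_eq_zero_or_eq_one.mp hr with h0 | h1
        · exact toX7 (hPP (Summit.BirchSwinnertonDyer.Rank1Residual.Supersingular.bsdp_of_kobayashiMainConjecture_of_analyticRank_eq_zero W p h12 hKim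
            Literature.NumberTheory.EllipticCurves.pollack_exists_plusMinusPAdicLFunction_holds hmodP hmod hGZK hp hX.1.1 hap
            (Literature.NumberTheory.EllipticCurves.Rank1Residual.ClassX7.irr W p hp hX) h0 hMC))
        · exact toX7 (hPP (Summit.BirchSwinnertonDyer.Rank1Residual.Supersingular.X7.bsdp_of_kobayashiMainConjecture_of_corA5_of_analyticRank_eq_one
            W p hA5 hmod hGZK hp hX hap h1 ε hMC))
    · -- `a_p ≠ 0` at a good supersingular prime forces `p = 3`, `a_3 = ±3`: the pair is in corner X8
      have hp3 : p = 3 := by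
        by_contra h3'
        have hpr : p.Prime := Fact.out
        have h5p : 5 ≤ p := by
          have h2 := hpr.two_le
          have h4 : p ≠ 4 := by intro h4; rw [h4] at hpr; norm_num at hpr
          omega
        exact hap (Summit.BirchSwinnertonDyer.Rank1Residual.Supersingular.ClassX7.frobeniusTrace_eq_zero_of_five_le W p h5p hX)
      subst hp3
      have hX' : Literature.NumberTheory.EllipticCurves.Rank1Residual.ClassX8 W 3 := ⟨rfl, hX.1, hap⟩
      obtain ⟨hlow8, hpp8⟩ := hX8 hX'
      exact ⟨fun h0 _ himg ↦ hlow8 h0 himg, fun hc ↦ hpp8 (fun hc' ↦ hc ⟨hc'.1, hp, hc'.2⟩)⟩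

/-- **Pre-requisite A of K3 turnkey #4 (pen g34): the bridge with ONLY crux 5 cut to `W.analyticRank ≤ 1`.**
Hypotheses `hB1 hB2 hB2' hR8 hPub` are VERBATIM those of `signedSupersingular_of_lowerHalves` (= the route
items `KobayashiLowerHalfSemistable`, `KobayashiLowerHalfLargeImage`, `KobayashiMainConjectureSmallImage`,
`SharpFlatResiduePPart`, `PublishedSignedInputs` unfolded); `hB3` is the text of `rankcut-crux5-g34/signature.txt`
(item-to-be `SprungLowerHalfAtThreeRankLeOne`). So `closes (…) (hB3 : SprungLowerHalfAtThreeRankLeOne) … :=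
signedSupersingular_of_lowerHalves_rankLeOne hB1 hB2 hB2' hB3 hR8 hPub` elaborates once that item exists.
From `signedSupersingular_of_lowerHalves_allCuts` by restricting `hB1`, `hB2`. Closes nothing.
[cite: Kobayashi2003, Thm. 1.2, Thm. 4.1 and Conjecture (p. 2)] [cite: Miller2011LMS, Def. 1.1] -/
theorem signedSupersingular_of_lowerHalves_rankLeOne
    (hB1 : ∀ (W : WeierstrassCurve ℚ) [W.IsElliptic] [W.IsGloballyMinimal] (p : ℕ) [Fact p.Prime], p ≠ 2 → Literature.NumberTheory.EllipticCurves.Rank1Residual.ClassX6 W p → ∃ ε : ℤˣ, Summit.BirchSwinnertonDyer.Rank1Residual.Supersingular.KobayashiLowerDivisibility W p ε)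
    (hB2 : ∀ (W : WeierstrassCurve ℚ) [W.IsElliptic] [W.IsGloballyMinimal] (p : ℕ) [Fact p.Prime], p ≠ 2 → Literature.NumberTheory.EllipticCurves.Rank1Residual.ClassX7 W p → ¬ W.HasCM → W.frobeniusTrace p = 0 → Literature.NumberTheory.EllipticCurves.Rank1Residual.Surj W p → ∃ ε : ℤˣ, Summit.BirchSwinnertonDyer.Rank1Residual.Supersingular.KobayashiLowerDivisibility W p ε)
    (hB2' : ∀ (W : WeierstrassCurve ℚ) [W.IsElliptic] [W.IsGloballyMinimal] (p : ℕ) [Fact p.Prime], p ≠ 2 → Literature.NumberTheory.EllipticCurves.Rank1Residual.ClassX7 W p → ¬ W.HasCM → W.frobeniusTrace p = 0 → ¬ Literature.NumberTheory.EllipticCurves.Rank1Residual.Surj W p → ∃ ε : ℤˣ, Summit.BirchSwinnertonDyer.Rank1Residual.Supersingular.KobayashiMainConjecture W p ε)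
    (hB3 : ∀ (W : WeierstrassCurve ℚ) [W.IsElliptic] [W.IsGloballyMinimal] (p : ℕ) [Fact p.Prime], Literature.NumberTheory.EllipticCurves.Rank1Residual.ClassX8 W p → W.analyticRank ≤ 1 → ∃ (N : ℕ) (_ : NeZero N) (f : CuspForm (CongruenceSubgroup.Gamma0 N) 2) (ϖ : ℚ) (Lsharp Lflat : Literature.NumberTheory.EllipticCurves.IwasawaAlgebra p) (c : Literature.NumberTheory.EllipticCurves.Sprung2017.Chroma) (ξ : Literature.NumberTheory.EllipticCurves.IwasawaAlgebra p), Literature.NumberTheory.EllipticCurves.ModularForms.IsNewformOf W f ∧ (ϖ : ℝ) * W.realPeriodRat = Literature.NumberTheory.EllipticCurves.ModularForms.plusPeriod f ∧ Literature.NumberTheory.EllipticCurves.Sprung2017.IsSprungPair f p (W.frobeniusTrace p) Lsharp Lflat ∧ (⟨ξ, 0, 0⟩ : Summit.BirchSwinnertonDyer.Rank1Residual.Supersingular.SignedDatum W p).EulerCharacteristic ∧ ∃ h : Literature.NumberTheory.EllipticCurves.IwasawaAlgebra p, Literature.NumberTheory.EllipticCurves.iwasawaToPowerSeries p ξ = PowerSeries.C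 (ϖ : ℚ_[p]) * Literature.NumberTheory.EllipticCurves.iwasawaToPowerSeries p (Literature.NumberTheory.EllipticCurves.Sprung2017.chromaticL c Lsharp Lflat * h))
    (hR8 : ∀ (W : WeierstrassCurve ℚ) [W.IsElliptic] [W.IsGloballyMinimal] (p : ℕ) [Fact p.Prime], Literature.NumberTheory.EllipticCurves.Rank1Residual.ClassX8 W p → W.analyticRank ≤ 1 → ¬ (W.analyticRank = 0 ∧ Literature.NumberTheory.EllipticCurves.Rank1Residual.Surj W p) → Literature.NumberTheory.EllipticCurves.Rank1Residual.Typed.MissingPPartAt W p)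
    (hPub : Literature.NumberTheory.EllipticCurves.Wuthrich2014.sha_dvd_analyticSha ∧ Literature.NumberTheory.EllipticCurves.Kobayashi2003.thm12_signedSelmerDual_finite_torsion ∧ Literature.NumberTheory.EllipticCurves.Kobayashi2003.thm41_signedCharIdeal_divisibility ∧ Literature.NumberTheory.EllipticCurves.BDKim2013.cor315_signedCharValue_rankZero ∧ Literature.NumberTheory.EllipticCurves.BurungaleKobayashiOta2024.corA5_pPart_of_signedCharIdeal_eq ∧ Literature.NumberTheory.EllipticCurves.realPeriodRat_eq_unit_mul_plusPeriod ∧ Literature.NumberTheory.EllipticCurves.realPeriodRat_eq_unit_mul_plusPeriod_three ∧ Literature.NumberTheory.EllipticCurves.ModularForms.nonempty_modularParametrizationData ∧ WeierstrassCurve.hasEntireLFunction_rat ∧ Literature.NumberTheory.EllipticCurves.rank_eq_analyticRank_of_analyticRank_le_one) :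
    Summit.BirchSwinnertonDyer.Rank1Residual.Supersingular.SignedSupersingular :=
  signedSupersingular_of_lowerHalves_allCuts (fun W _ _ p _ hp hX _ ↦ hB1 W p hp hX)
    (fun W _ _ p _ hp hX hcm hap hs _ ↦ hB2 W p hp hX hcm hap hs) hB2' hB3 hR8 hPub

end Summit.BirchSwinnertonDyer.BirchSwinnertonDyer.Theorems.SignedSupersingular

end
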